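import Summits.AtomisticToContinuum.BoseEinsteinCondensation.Theorems.BECThomsonPrincipleFibreConductanceOccupationContinuity
import HarnessLib

/-!
# Route `BECThomsonPrinciple`, crux `FibreConductance` (stmt-AtomisticToContinuum-9480):
# the crux forces an ABSOLUTE sub-extensive single-mode occupation bound on exact ground states

`occupationContinuity_of_fibreConductance` (p125599) is the crux's infrared content in RELATIVE form:
on every exact zero-free datum `(m, L, n, Φ)` of the crux's window and for every lattice vector `P`,
`n_{P−n'}(|Φ|) ≤ 2 n_{−n'}(|Φ|) + 8π²C|P|₂²N/‖n'‖∞²` at every admissible datum `n'`. This file removes the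
reference occupation `n_{−n'}` by a pigeonhole over source data: the `(R+1)³` lattice vectors `n'` with
`‖n' − n‖∞ ≤ R`, chosen coordinatewise on the side of `n` facing the origin, are again window data
(`‖n'‖∞ ≤ ‖n‖∞`, `n' ≠ 0` once `2R ≤ ‖n‖∞`), their source occupations add up to at most
`Σ_p n_p(|Φ|) = N` (Parseval for the modulus, `tsum_cellOccupation_modulus`), so one of them has
`n_{−n'}(|Φ|) ≤ N/(R+1)³`, and continuity from that datum with `P = n' − n` (`|P|₂² ≤ 3R²`,
`‖n'‖∞ ≥ ‖n‖∞/2`) gives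

* `occupation_le_radius_of_fibreConductance`:
  `n_{−n}(|Φ|) ≤ (2/(R+1)³ + 96π²C R²/‖n‖∞²)·N` for every `R : ℕ` with `2R ≤ ‖n‖∞`;
* `singleModeOccupation_of_fibreConductance` (`R = ⌊‖n‖∞^{2/5}⌋`):
  `n_{−n}(|Φ|) ≤ (4 + 96π²C)·N/‖n‖∞^{6/5}` on EVERY datum of the window (the window is symmetric under
  `n ↦ −n`, so this is a bound on every window mode of the modulus of every exact zero-free minimiser).

Reading (numbers): at the top of the window, `‖n‖∞ = M√ρL/2π`, the right-hand side is
`(4 + 96π²C)(2π/M)^{6/5}ρ^{-1/5}·N^{3/5}` particles in ONE plane-wave mode, uniformly in the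
thermodynamic limit at density `≤ ρ₀`. The kinetic sum rule `Σ_p|k_p|²n_p ≤ T ≲ 4πaρN` bounds the same
mode only by `4πaN/M² = O(N)`; the Gaussian-domination / Kennedy–Lieb–Shastry shape that cruxes
`GaussianDominationCan` (stmt-9479) and `GDTransfer` (stmt-9482) are built to deliver is
`O(√ρL/|p|) = O(1)` there. So the necessary content of `FibreConductance` sits strictly between the two:
a sub-extensive (`N^{3/5}`) single-mode occupation law for the exact interacting ground state in the
thermodynamic limit — weaker than Gaussian domination, but not supplied by any energy method (this is
the quantitative form of the `line-dead` certificates `Cruxes/FibreConductance/Lines/*-dead.md`).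

References: LSSY2005 §1.2 (1.17)–(1.18) (occupations, `Σ_p n_p = N`); T. Kennedy, E. H. Lieb,
B. S. Shastry, J. Stat. Phys. 53 (1988) 1019 (shape of Gaussian-domination occupation bounds);
crux workfiles `Cruxes/FibreConductance/NOTES.md`, `PICKED.md` (seat a2).
-/

noncomputable section

namespace Summit.AtomisticToContinuum.BoseEinsteinCondensation.Cruxes.FibreConductance.SingleModeBound

open MeasureTheory
open scoped ENNReal
open Literature.MathematicalPhysics.QuantumManyBody.BoseGas
open Summit.AtomisticToContinuum.BoseEinsteinCondensation.Theses.BECThomsonPrinciple (FibreConductance)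
open Summit.AtomisticToContinuum.BoseEinsteinCondensation.Theorems.GaussianDominationCan.Negative
  (nsq nsq_nonneg)
open Summit.AtomisticToContinuum.BoseEinsteinCondensation.Cruxes.FibreConductance.ParsevalShellBootstrap
  (LowDensityWindow)
open Summit.AtomisticToContinuum.BoseEinsteinCondensation.Cruxes.FibreConductance.CondensateFloor
  (occupationContinuity_of_fibreConductance)

variable {m : ℕ} {L : ℝ}

/-! ## Parseval for the modulus and the pigeonhole -/

/-- **Parseval for the modulus**: the plane-wave occupations of `X ↦ |Φ X|` add up to the particle
number, `Σ_{p ∈ ℤ³} n_p(|Φ|) = N` (`|Φ|` is continuous with `∫|Φ|² = 1`; no periodicity or symmetry is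
needed for the trace identity). [folklore] -/
theorem tsum_cellOccupation_modulus (hL : 0 < L) (Φ : PeriodicTrialState (m + 1) L) :
    ∑' p : Fin 3 → ℤ, cellOccupation (m + 1) L (planeWaveMode L p) (fun X => (‖Φ.ψ X‖ : ℂ)) =
      ((m + 1 : ℕ) : ℝ≥0∞) := by
  have hc : Continuous fun X => ((‖Φ.ψ X‖ : ℝ) : ℂ) :=
    Complex.continuous_ofReal.comp Φ.contDiff.continuous.norm
  rw [tsum_cellOccupation_planeWaveMode_eq hL hc]
  have h1 : ∫⁻ X in cellN (m + 1) L, (‖((‖Φ.ψ X‖ : ℝ) : ℂ)‖₊ : ℝ≥0∞) ^ 2 = 1 := by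
    simp_rw [Complex.nnnorm_real, nnnorm_norm]
    exact Φ.norm_eq
  rw [h1, mul_one]

/-- Every single plane-wave occupation of the modulus is at most `N`. [folklore] -/
theorem cellOccupation_modulus_le (hL : 0 < L) (Φ : PeriodicTrialState (m + 1) L) (p : Fin 3 → ℤ) :
    cellOccupation (m + 1) L (planeWaveMode L p) (fun X => (‖Φ.ψ X‖ : ℂ)) ≤ ((m + 1 : ℕ) : ℝ≥0∞) := by
  rw [← tsum_cellOccupation_modulus hL Φ]
  exact ENNReal.le_tsum p

/-- **Pigeonhole over source modes**: in any finite set `S` of lattice vectors some `n' ∈ S` has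
`|S| · n_{−n'}(|Φ|) ≤ N`. [folklore] -/
theorem exists_card_mul_cellOccupation_le (hL : 0 < L) (Φ : PeriodicTrialState (m + 1) L)
    {S : Finset (Fin 3 → ℤ)} (hS : S.Nonempty) :
    ∃ n' ∈ S, (S.card : ℝ≥0∞) *
        cellOccupation (m + 1) L (planeWaveMode L (-n')) (fun X => (‖Φ.ψ X‖ : ℂ)) ≤
      ((m + 1 : ℕ) : ℝ≥0∞) := by
  set f : (Fin 3 → ℤ) → ℝ≥0∞ := fun p =>
    cellOccupation (m + 1) L (planeWaveMode L (-p)) (fun X => (‖Φ.ψ X‖ : ℂ)) with hf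
  obtain ⟨n', hn', hmin⟩ := S.exists_min_image f hS
  refine ⟨n', hn', ?_⟩
  have hsum : ∑ p ∈ S, f p ≤ ((m + 1 : ℕ) : ℝ≥0∞) := by
    calc ∑ p ∈ S, f p ≤ ∑' p : Fin 3 → ℤ, f p := ENNReal.sum_le_tsum S
      _ = ∑' p : Fin 3 → ℤ,
            cellOccupation (m + 1) L (planeWaveMode L p) (fun X => (‖Φ.ψ X‖ : ℂ)) :=
          (Equiv.neg (Fin 3 → ℤ)).tsum_eq fun p =>
            cellOccupation (m + 1) L (planeWaveMode L p) (fun X => (‖Φ.ψ X‖ : ℂ))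
      _ = _ := tsum_cellOccupation_modulus hL Φ
  have h := Finset.card_nsmul_le_sum S f (f n') fun p hp => hmin p hp
  rw [nsmul_eq_mul] at h
  exact h.trans hsum

/-! ## The source data: a cube of `(R+1)³` admissible data next to `n` -/

/-- The source datum attached to an offset `d ∈ {0,…,R}³`: move each coordinate of `n` by `d_j`
TOWARDS the origin (so that the sup norm does not increase). [folklore] -/
theorem source_spec (n : Fin 3 → ℤ) {R : ℕ} (d : Fin 3 → Fin (R + 1)) (j : Fin 3) :
    let n' : Fin 3 → ℤ := fun j => if 0 ≤ n j then n j - d j else n j + d j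
    |((n' j : ℤ) : ℝ) - n j| ≤ R ∧ |((n' j : ℤ) : ℝ)| ≤ max |(n j : ℝ)| R := by
  have hd : ((d j : ℕ) : ℝ) ≤ R := by exact_mod_cast Nat.lt_succ_iff.1 (d j).isLt
  have hd0 : (0 : ℝ) ≤ ((d j : ℕ) : ℝ) := Nat.cast_nonneg _
  dsimp only
  split_ifs with h
  · have h' : (0 : ℝ) ≤ n j := by exact_mod_cast h
    push_cast
    refine ⟨by rw [show (n j : ℝ) - (d j : ℕ) - n j = -((d j : ℕ) : ℝ) by ring, abs_neg,
      abs_of_nonneg hd0]; exact hd, abs_le.2 ⟨?_, ?_⟩⟩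
    · have := le_max_right |(n j : ℝ)| (R : ℝ); linarith
    · have : (n j : ℝ) ≤ max |(n j : ℝ)| R := (le_abs_self _).trans (le_max_left _ _)
      linarith
  · have h' : (n j : ℝ) < 0 := by exact_mod_cast lt_of_not_ge h
    push_cast
    refine ⟨by rw [show (n j : ℝ) + (d j : ℕ) - n j = ((d j : ℕ) : ℝ) by ring,
      abs_of_nonneg hd0]; exact hd, abs_le.2 ⟨?_, ?_⟩⟩
    · have : -(n j : ℝ) ≤ max |(n j : ℝ)| R := (neg_le_abs _).trans (le_max_left _ _)
      linarith
    · have := le_max_right |(n j : ℝ)| (R : ℝ); linarith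

/-- The offset map `d ↦ n'` is injective, so the source cube has exactly `(R+1)³` data. [folklore] -/
theorem source_injective (n : Fin 3 → ℤ) (R : ℕ) :
    Function.Injective fun (d : Fin 3 → Fin (R + 1)) (j : Fin 3) =>
      if 0 ≤ n j then n j - d j else n j + d j := by
  intro d d' h
  funext j
  have hj := congr_fun h j
  dsimp only at hj
  apply Fin.ext
  split_ifs at hj with h0 <;> omega

/-! ## The absolute bounds -/

/-- **Occupation bound at radius `R`** — the crux's infrared content with the reference occupation
removed by pigeonhole: `FibreConductance` forces, with its own `ρ₀, C, N₀`, on every exact zero-free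
datum of its window and for every `R : ℕ` with `2R ≤ ‖n‖∞`,
`n_{−n}(|Φ|) ≤ (2/(R+1)³ + 96π² C R²/‖n‖∞²)·N`. [folklore] -/
theorem occupation_le_radius_of_fibreConductance : FibreConductance →
    LowDensityWindow fun m L n Φ C => ∀ R : ℕ, 2 * (R : ℝ) ≤ ‖(fun j => (n j : ℝ))‖ →
      cellOccupation (m + 1) L (planeWaveMode L (-n)) (fun X => (‖Φ.ψ X‖ : ℂ)) ≤
        ENNReal.ofReal (2 / ((R : ℝ) + 1) ^ 3 +
            96 * Real.pi ^ 2 * C * (R : ℝ) ^ 2 / ‖(fun j => (n j : ℝ))‖ ^ 2) *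
          (m + 1 : ℝ≥0∞) := by
  intro h v hv hbdd M hM
  obtain ⟨ρ₀, C, hρ₀, hC, N₀, hmain⟩ := occupationContinuity_of_fibreConductance h v hv hbdd M hM
  refine ⟨ρ₀, C, hρ₀, hC, N₀, fun m hm L hL hρ n hn hw Φ hE hz R hR => ?_⟩
  -- the datum's sup norm `a = ‖n‖∞ > 0`
  set a : ℝ := ‖(fun j => (n j : ℝ))‖ with ha
  have hn_real : (fun j => (n j : ℝ)) ≠ 0 := by
    intro h0
    apply hn
    funext j
    have : (n j : ℝ) = 0 := by simpa using congr_fun h0 j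
    rw [Pi.zero_apply]
    exact_mod_cast this
  have ha0 : 0 < a := norm_pos_iff.2 hn_real
  have hRa : (R : ℝ) ≤ a / 2 := by linarith
  -- the source cube
  set src : (Fin 3 → Fin (R + 1)) → (Fin 3 → ℤ) := fun d j =>
    if 0 ≤ n j then n j - d j else n j + d j with hsrc
  set S : Finset (Fin 3 → ℤ) := Finset.univ.image src with hS
  have hScard : S.card = (R + 1) ^ 3 := by
    rw [hS, Finset.card_image_of_injective _ (source_injective n R), Finset.card_univ,
      Fintype.card_fun, Fintype.card_fin, Fintype.card_fin]
  have hSne : S.Nonempty := Finset.card_pos.1 (by rw [hScard]; positivity)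
  -- pigeonhole: a source datum `n' = src d` with small source occupation
  obtain ⟨n', hn'S, hpig⟩ := exists_card_mul_cellOccupation_le hL Φ hSne
  rw [hScard] at hpig
  obtain ⟨d, -, hd⟩ := Finset.mem_image.1 hn'S
  -- coordinates of `n'`
  have hcoord : ∀ j, |((n' j : ℤ) : ℝ) - n j| ≤ R ∧ |((n' j : ℤ) : ℝ)| ≤ max |(n j : ℝ)| R := by
    intro j
    have := source_spec n d j
    rw [← hd]
    exact this
  -- `‖n' − n‖∞ ≤ R`, `‖n'‖∞ ≤ a`, `‖n'‖∞ ≥ a − R ≥ a/2`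
  have hdiff : ‖(fun j => (n' j : ℝ)) - (fun j => (n j : ℝ))‖ ≤ R := by
    refine (pi_norm_le_iff_of_nonneg (Nat.cast_nonneg R)).2 fun j => ?_
    rw [Pi.sub_apply, Real.norm_eq_abs]
    exact (hcoord j).1
  have hle : ‖(fun j => (n' j : ℝ))‖ ≤ a := by
    refine (pi_norm_le_iff_of_nonneg ha0.le).2 fun j => ?_
    rw [Real.norm_eq_abs]
    refine (hcoord j).2.trans (max_le ?_ (by linarith))
    have := norm_le_pi_norm (fun j => (n j : ℝ)) j
    rwa [Real.norm_eq_abs] at this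
  have hge : a / 2 ≤ ‖(fun j => (n' j : ℝ))‖ := by
    have := norm_sub_norm_le (fun j => (n j : ℝ)) (fun j => (n' j : ℝ))
    rw [norm_sub_rev] at this
    linarith
  have hn'0 : n' ≠ 0 := by
    intro h0
    have : ‖(fun j => (n' j : ℝ))‖ = 0 := by
      rw [h0]; simp
    linarith
  have hw' : 2 * Real.pi * ‖(fun j => (n' j : ℝ))‖ / L ≤ M * Real.sqrt ((m + 1 : ℕ) / L ^ 3) := by
    refine le_trans ?_ hw
    have h2 : 0 ≤ 2 * Real.pi / L := by positivity
    calc 2 * Real.pi * ‖(fun j => (n' j : ℝ))‖ / L = 2 * Real.pi / L * ‖(fun j => (n' j : ℝ))‖ := by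
          ring
      _ ≤ 2 * Real.pi / L * a := mul_le_mul_of_nonneg_left hle h2
      _ = 2 * Real.pi * a / L := by ring
  -- occupation continuity from the datum `n'` with shift `P = n' − n` (target mode `−n`)
  have hcont := hmain m hm L hL hρ n' hn'0 hw' Φ hE hz (n' - n)
  rw [sub_sub_cancel_left] at hcont
  -- the real bookkeeping: `8π²C |P|² / ‖n'‖² ≤ 96π²C R²/a²`
  have hnsq : nsq (n' - n) ≤ 3 * (R : ℝ) ^ 2 := by
    have hj : ∀ j, (((n' - n) j : ℤ) : ℝ) ^ 2 ≤ (R : ℝ) ^ 2 := by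
      intro j
      rw [Pi.sub_apply, Int.cast_sub]
      have h1 := (hcoord j).1
      rw [abs_le] at h1
      nlinarith [h1.1, h1.2]
    unfold nsq
    rw [Fin.sum_univ_three]
    linarith [hj 0, hj 1, hj 2]
  have hreal : 8 * Real.pi ^ 2 * C * nsq (n' - n) / ‖(fun j => (n' j : ℝ))‖ ^ 2 ≤
      96 * Real.pi ^ 2 * C * (R : ℝ) ^ 2 / a ^ 2 := by
    have ha2 : 0 < a / 2 := by positivity
    calc 8 * Real.pi ^ 2 * C * nsq (n' - n) / ‖(fun j => (n' j : ℝ))‖ ^ 2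
        ≤ 8 * Real.pi ^ 2 * C * (3 * (R : ℝ) ^ 2) / (a / 2) ^ 2 := by
          gcongr
      _ = 96 * Real.pi ^ 2 * C * (R : ℝ) ^ 2 / a ^ 2 := by
          field_simp
          ring
  -- ENNReal assembly
  have hocc' : cellOccupation (m + 1) L (planeWaveMode L (-n')) (fun X => (‖Φ.ψ X‖ : ℂ)) ≤
      ENNReal.ofReal (1 / ((R : ℝ) + 1) ^ 3) * (m + 1 : ℝ≥0∞) := by
    have ht : 0 < ((R : ℝ) + 1) ^ 3 := by positivity
    have hcast : (((R + 1) ^ 3 : ℕ) : ℝ≥0∞) = ENNReal.ofReal (((R : ℝ) + 1) ^ 3) := by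
      rw [← ENNReal.ofReal_natCast]
      push_cast
      rfl
    have hone : ENNReal.ofReal (1 / ((R : ℝ) + 1) ^ 3) * (((R + 1) ^ 3 : ℕ) : ℝ≥0∞) = 1 := by
      rw [hcast, ← ENNReal.ofReal_mul (by positivity), one_div, inv_mul_cancel₀ ht.ne',
        ENNReal.ofReal_one]
    have hN : ((m + 1 : ℕ) : ℝ≥0∞) = (m + 1 : ℝ≥0∞) := by push_cast; rfl
    calc cellOccupation (m + 1) L (planeWaveMode L (-n')) (fun X => (‖Φ.ψ X‖ : ℂ))
        = ENNReal.ofReal (1 / ((R : ℝ) + 1) ^ 3) * ((((R + 1) ^ 3 : ℕ) : ℝ≥0∞) *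
            cellOccupation (m + 1) L (planeWaveMode L (-n')) (fun X => (‖Φ.ψ X‖ : ℂ))) := by
          rw [← mul_assoc, hone, one_mul]
      _ ≤ ENNReal.ofReal (1 / ((R : ℝ) + 1) ^ 3) * ((m + 1 : ℕ) : ℝ≥0∞) :=
          mul_le_mul' le_rfl (by exact_mod_cast hpig)
      _ = _ := by rw [hN]
  have h2 : (2 : ℝ≥0∞) * (ENNReal.ofReal (1 / ((R : ℝ) + 1) ^ 3) * (m + 1 : ℝ≥0∞)) =
      ENNReal.ofReal (2 / ((R : ℝ) + 1) ^ 3) * (m + 1 : ℝ≥0∞) := by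
    rw [← mul_assoc, ← ENNReal.ofReal_ofNat 2, ← ENNReal.ofReal_mul (by norm_num)]
    congr 2
    ring
  have hX0 : 0 ≤ 2 / ((R : ℝ) + 1) ^ 3 := by positivity
  have hY0 : 0 ≤ 96 * Real.pi ^ 2 * C * (R : ℝ) ^ 2 / a ^ 2 := by
    have := hC.le
    positivity
  calc cellOccupation (m + 1) L (planeWaveMode L (-n)) (fun X => (‖Φ.ψ X‖ : ℂ))
      ≤ 2 * cellOccupation (m + 1) L (planeWaveMode L (-n')) (fun X => (‖Φ.ψ X‖ : ℂ)) +
          ENNReal.ofReal (8 * Real.pi ^ 2 * C * nsq (n' - n) / ‖(fun j => (n' j : ℝ))‖ ^ 2) *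
            (m + 1 : ℝ≥0∞) := hcont
    _ ≤ 2 * (ENNReal.ofReal (1 / ((R : ℝ) + 1) ^ 3) * (m + 1 : ℝ≥0∞)) +
          ENNReal.ofReal (96 * Real.pi ^ 2 * C * (R : ℝ) ^ 2 / a ^ 2) * (m + 1 : ℝ≥0∞) := by
        gcongr
    _ = ENNReal.ofReal (2 / ((R : ℝ) + 1) ^ 3 + 96 * Real.pi ^ 2 * C * (R : ℝ) ^ 2 / a ^ 2) *
          (m + 1 : ℝ≥0∞) := by
        rw [h2, ← add_mul, ← ENNReal.ofReal_add hX0 hY0]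

/-- **SINGLE-MODE OCCUPATION BOUND — the crux's infrared content in absolute form.**
`FibreConductance` forces (with the crux's `ρ₀, N₀` and the constant `4 + 96π²C`) on every exact
zero-free datum of its window `n_{−n}(|Φ|) ≤ (4 + 96π²C)·N/‖n‖∞^{6/5}`: at the top of the window
`O(N^{3/5})` particles in one mode, uniformly in the thermodynamic limit — below the `O(N)` of the
kinetic sum rule, above the `O(1)` of the Gaussian-domination shape. (`R = ⌊‖n‖∞^{2/5}⌋` in
`occupation_le_radius_of_fibreConductance` when `‖n‖∞^{3/5} ≥ 2`; the trivial `n_{−n} ≤ N`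
otherwise.) [folklore] -/
theorem singleModeOccupation_of_fibreConductance : FibreConductance →
    LowDensityWindow fun m L n Φ C =>
      cellOccupation (m + 1) L (planeWaveMode L (-n)) (fun X => (‖Φ.ψ X‖ : ℂ)) ≤
        ENNReal.ofReal (C / ‖(fun j => (n j : ℝ))‖ ^ (6 / 5 : ℝ)) * (m + 1 : ℝ≥0∞) := by
  intro h v hv hbdd M hM
  obtain ⟨ρ₀, C, hρ₀, hC, N₀, hmain⟩ := occupation_le_radius_of_fibreConductance h v hv hbdd M hM
  refine ⟨ρ₀, 4 + 96 * Real.pi ^ 2 * C, hρ₀, by positivity, N₀,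
    fun m hm L hL hρ n hn hw Φ hE hz => ?_⟩
  set a : ℝ := ‖(fun j => (n j : ℝ))‖ with ha
  have hn_real : (fun j => (n j : ℝ)) ≠ 0 := by
    intro h0
    apply hn
    funext j
    have : (n j : ℝ) = 0 := by simpa using congr_fun h0 j
    rw [Pi.zero_apply]
    exact_mod_cast this
  have ha0 : 0 < a := norm_pos_iff.2 hn_real
  have hN : ((m + 1 : ℕ) : ℝ≥0∞) = (m + 1 : ℝ≥0∞) := by push_cast; rfl
  have htriv : cellOccupation (m + 1) L (planeWaveMode L (-n)) (fun X => (‖Φ.ψ X‖ : ℂ)) ≤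
      (m + 1 : ℝ≥0∞) := hN ▸ cellOccupation_modulus_le hL Φ (-n)
  -- fifth root `b = a^{1/5}`: everything becomes polynomial in `b`
  set b : ℝ := a ^ (1 / 5 : ℝ) with hb
  have hb0 : 0 < b := Real.rpow_pos_of_pos ha0 _
  have hab : a = b ^ 5 := by
    rw [hb, ← Real.rpow_natCast, ← Real.rpow_mul ha0.le]
    norm_num
  have ha65 : a ^ (6 / 5 : ℝ) = b ^ 6 := by
    rw [hab, ← Real.rpow_natCast b 5, ← Real.rpow_mul hb0.le, ← Real.rpow_natCast b 6]
    norm_num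
  rw [ha65]
  have hK0 : 0 < 4 + 96 * Real.pi ^ 2 * C := by positivity
  by_cases hcase : 2 ≤ b ^ 3
  · -- `R = ⌊b²⌋`: `2R ≤ 2b² ≤ b⁵ = a`, `(R+1)³ > b⁶`, `R² ≤ b⁴`
    set R : ℕ := ⌊b ^ 2⌋₊ with hR
    have hRle : (R : ℝ) ≤ b ^ 2 := Nat.floor_le (by positivity)
    have hRlt : b ^ 2 < (R : ℝ) + 1 := Nat.lt_floor_add_one _
    have h2R : 2 * (R : ℝ) ≤ a := by
      rw [hab]; nlinarith [sq_nonneg b]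
    have key := hmain m hm L hL hρ n hn hw Φ hE hz R h2R
    refine key.trans (mul_le_mul' (ENNReal.ofReal_le_ofReal ?_) le_rfl)
    have hR0 : (0 : ℝ) ≤ R := Nat.cast_nonneg R
    have hb6 : b ^ 6 ≤ ((R : ℝ) + 1) ^ 3 := by
      have : (b ^ 2) ^ 3 ≤ ((R : ℝ) + 1) ^ 3 :=
        pow_le_pow_left₀ (by positivity) hRlt.le 3
      calc b ^ 6 = (b ^ 2) ^ 3 := by ring
        _ ≤ _ := this
    have h1 : 2 / ((R : ℝ) + 1) ^ 3 ≤ 2 / b ^ 6 :=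
      div_le_div_of_nonneg_left (by norm_num) (by positivity) hb6
    have h2 : 96 * Real.pi ^ 2 * C * (R : ℝ) ^ 2 / a ^ 2 ≤ 96 * Real.pi ^ 2 * C / b ^ 6 := by
      rw [hab, div_le_div_iff₀ (by positivity) (by positivity)]
      have hR4 : (R : ℝ) ^ 2 ≤ b ^ 4 := by nlinarith
      have hc0 : 0 ≤ 96 * Real.pi ^ 2 * C := by have := hC.le; positivity
      calc 96 * Real.pi ^ 2 * C * (R : ℝ) ^ 2 * b ^ 6
          ≤ 96 * Real.pi ^ 2 * C * b ^ 4 * b ^ 6 := by gcongr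
        _ = 96 * Real.pi ^ 2 * C * (b ^ 5) ^ 2 := by ring
    calc 2 / ((R : ℝ) + 1) ^ 3 + 96 * Real.pi ^ 2 * C * (R : ℝ) ^ 2 / a ^ 2
        ≤ 2 / b ^ 6 + 96 * Real.pi ^ 2 * C / b ^ 6 := add_le_add h1 h2
      _ = (2 + 96 * Real.pi ^ 2 * C) / b ^ 6 := by rw [add_div]
      _ ≤ (4 + 96 * Real.pi ^ 2 * C) / b ^ 6 := by gcongr; norm_num
  · -- small `‖n‖∞`: `b⁶ < 4 ≤ 4 + 96π²C`, so the constant mode count `N` is already below the bound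
    have hb3 : b ^ 3 < 2 := lt_of_not_ge hcase
    have hb6 : b ^ 6 < 4 := by nlinarith [pow_pos hb0 3]
    have hone : (1 : ℝ) ≤ (4 + 96 * Real.pi ^ 2 * C) / b ^ 6 := by
      rw [le_div_iff₀ (by positivity), one_mul]
      have := hC.le
      nlinarith [Real.pi_pos]
    calc cellOccupation (m + 1) L (planeWaveMode L (-n)) (fun X => (‖Φ.ψ X‖ : ℂ))
        ≤ (m + 1 : ℝ≥0∞) := htriv
      _ = 1 * (m + 1 : ℝ≥0∞) := (one_mul _).symm
      _ ≤ ENNReal.ofReal ((4 + 96 * Real.pi ^ 2 * C) / b ^ 6) * (m + 1 : ℝ≥0∞) :=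
          mul_le_mul' (ENNReal.one_le_ofReal.2 hone) le_rfl

end Summit.AtomisticToContinuum.BoseEinsteinCondensation.Cruxes.FibreConductance.SingleModeBound

end
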